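/- Copyright: the b2b-balaban cell (near-miss cell 7), T⁴-continuum fan-out, lineage t4-ne7b-p1 (row NE7b OWNER + CRUX
PROVER NE7b), gen 45: (α)-M5-3b «THE CREDIT READING».  Released under the licence of the surrounding project. -/
import Summits.QuantumFields.BalabanUV.T4Continuum.Support.HistoryBankingDiscountCharge
import Summits.QuantumFields.BalabanUV.T4Continuum.Support.HistoryGenealogyExtractionLedger
import Summits.QuantumFields.BalabanUV.T4Continuum.Support.HistoryGenAdm

/-!
# History banking, M5-3b: THE CREDIT READING — print's SHARP per-event factors, read event-wise WITH ROOM, pay print's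
booked credits AND the count's displaced discount: `evProd (fB) (fR) P ≤ e^{−credits (pcredit ∘ sh) G}·e^{−Ξ(G)}`
(re-open object (α) of row NE7b, `SCOPE-alpha.md` §5 row M5, part M5-3, second half; ruling R-OWNER-45-1, owner gen 45)

Summits-side support leaf of the T⁴-continuum cell (rung (B)+1 on a FINITE torus only; NOT infinite volume, NOT the
mass gap, NOT the Clay statement; NOT a proof of the spine estimate NE7b — the cell's OWN estimate, NOT PRINTED, NOT
PROVED).  [folklore] bookkeeping over the lineage's own carriers: the sibling `HistoryBankingDiscountCharge` (M5-3a: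
`dshare`, `sharpT`, `RoundingRoom`, `exp_neg_sharps_le`), the owner's census carrier `HistoryAdmissible.PGen` with its
canonical label `PGen.toGen` and the event product `HistoryGenealogyExtraction.evProd` (M3a ledger), the bridge
`HistoryGen.Pedigree.shape_genT_eq_toGen` (`HistoryGenAdm`), and `T4BranchingRecordsGas.{relabel, shape}`; no `[cite:]`
tag, nothing printed asserted, no `def … : Prop` fact of Bałaban's (`FactorRead` is a displayed HYPOTHESIS structure on
the VALUES of M2 brick B's factor data, inhabited by toy data in §4), zero `sorry`.

WHY (R-OWNER-45-1, answering PRICING-NE7b v12 F65 on the owner's located question Q-44-1).  The refuter priced the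
credit reading (R1) as «not payable per birth K-uniformly» because, AS THE MODEL BOOKS IT, a renewal carries
`e^{−p₀(g_h)} = e^{−pcredit}` EXACTLY — no room for its share of the count's discount `Ξ = 8∕E₂·totalCostT +
4·partnerAges`.  LOCATED RE-READING ([B16] = [Balaban1989LargeFieldII], a manuscript UNDER AUDIT; locators only): the
renewal's «new factor exp(−p₀(g_j))» of p. 386 l. 1 is print's ROUNDING, on p. 383 after (1.78), of the largest
preparatory large-field factor — «… yield the following large field factor: exp(−½γ₀[6(d+3)(100M(L+1)N^{β₀}R_j)^{d+2}]⁻¹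
A₁²p₁²(g_j)) < exp(−R_j^{−d−5}p₁²(g_j)).  This is the largest factor among all the small factors we have obtained from the
large field characteristic functions in the preparatory steps.  We assume that 2p₁ − (d + 5)r₀ > p₀, and we estimate the
factors by exp(−p₀(g_j))» — typed by lit-balaban r13 as `B16Sect1Kernels.lfFactor178`, `ExponentProviso383` and
`exp_lfFactor_le_exp_neg_p0` (the proviso gives `exp(−R_j^{−d−5}p₁²(g_j)) ≤ exp(−p₀(g_j))`).  The proviso is a STRICT
inequality between the degrees in `ℓ = log g_j⁻²` of the sharp exponent (`ℓ^{2p₁−(d+5)r₀}`) and of `p₀(g_j)`, so the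
rounding carries room `p₀(g_j)·(ℓ^{η} − 1)`, `η > 0`, against a renewal share `8·W·(L R)^{q′} + 4·W = O(ℓ^{(d+2)r₀})`
that print's own pay clauses keep below `p₀(g_j)`: room ≥ share as soon as `ℓ^{η} ≥ 2` — «g_j sufficiently small», the
status of print's own rounding.  Births carry the quadratic room of the fundamental factor's `min{½B₃⁻²A₀², 2A₁², A₁²}`
against the booked `½γ₀A₁²` in the strict interior (P♯) `A₁ ≤ A₀∕(√2·B₃)` (the refuter's located side condition, F65
(2)); mergers carry no factor and are charged to the absorbed root (sibling §4).  HENCE (R1) IS PAYABLE PER EVENT,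
K-UNIFORMLY, WITHOUT RE-CUTTING `Ξ` IN THE END: this file proves the factor inequality from the DISPLAYED event-wise
readings (`FactorRead`: `0 ≤ fB ≤ e^{−sB}`, `0 ≤ fR ≤ e^{−sR}`) and the sibling's junction `RoundingRoom` (the two
roundings READ WITH ROOM) — both R-class displays, the honest residue of `priceM`'s credit part (WALL §2), replacing the
single undifferentiated reading «(R1)».  The refuter's END v3.2 (re-cut per window) remains an equivalent alternative.

WHAT.  §1 **`FactorRead fB fR sB sR`** (display) and `evProd_nonneg`.  §2 THE BRIDGE **`evProd_le_exp_neg_sharps`**: for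
`relabel sh G = P.toGen`, `G.WF W`: `evProd fB fR P ≤ exp (−Σ_{e ∈ G.events} sharpT sB sR (sh e))` (induction à la
`HistoryBankingVolumePlug.blin_eq_birthWT`).  §3 **`evProd_le_exp_neg_credits_mul_exp_neg_discount`**: with the sibling's
`exp_neg_sharps_le` — `evProd fB fR P ≤ exp (−credits (pcredit O C g ∘ sh) G) · exp (−(8∕C.E₂·totalCostT sh C K R G +
4·partnerAges (PEv.step ∘ sh) G))` under `FactorRead`, `RoundingRoom`, (2.9), `L ≥ 1`, `E₂ > 0`, `E₃ ≥ 0`, `ConsistentTLE`,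
`WF`; `sharpT_shape` and the `Pedigree` form **`evProd_toPGen_le_genT`** (shape `Prod.fst`, over `toPGen cell c` ∕ `genT c`,
via `shape_genT_eq_toGen`) — EXACTLY the per-live-member inequality the `κ := costT` price sentence `priceM` of
`HistoryRealiseCellsRunApexT3bWTV(S)` asks of M2 brick B's event products (`B16HistoryWeightPlug.weight_le_live_mul_dead`).
§4 Sanity: `FactorRead` and `RoundingRoom` inhabited by toy letters; the whole chain on the decided toy merger
`T4TaggedShapeBanking.Sanity.Zt`.

HONEST SCOPE.  Bookkeeping; `FactorRead` ∕ `RoundingRoom` are HYPOTHESIS shapes (the VALUES `fB`, `fR`, `sB`, `sR` are the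
supplier's — balaban-calc ∕ the reading of (B)); nothing of H3 ∕ (B) ∕ BetaPertH is discharged; the plug into `priceM` on
the pass-V objects (M5-4: `wf`∕`ConsistentTLE` of `pedMV.genT`, the members' identification) is NOT done here.  BY-NAME
EFFECT ON THE WALL: `priceM`'s credit part becomes kernel MODULO the two displays (recorded in `WALL-NE7b-P1.md` v1.19).
NE7b NOT proved; spine 0∕9.  HONEST DEPENDENCY (cell): continuum YM on T⁴ ⇐ BetaPertH ∧ nine spine estimates (0/9
proved); BetaPertH ⇐ (D1) ∧ (D4) ∧ CAP+tail; G-an2-4 gates asym, D1 and NE2/3/4.  This file changes none of it.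
-/

open Finset
open Literature.MathematicalPhysics.QuantumFieldTheory.Balaban1983to89
open T4PersistenceDictionary T4PrintedShapeBanking T4BankedInduction T4TaggedShapeBanking T4PartnerMultiplicity
open T4BranchingRecordsGas
open Summit.QuantumFields.BalabanUV.T4Continuum.HistoryBankingLE
open Summit.QuantumFields.BalabanUV.T4Continuum.HistoryConstants
open Summit.QuantumFields.BalabanUV.T4Continuum.HistoryBankingDiscountCharge
open Summit.QuantumFields.BalabanUV.T4Continuum.HistoryAdmissible
open Summit.QuantumFields.BalabanUV.T4Continuum.HistoryGenealogyExtraction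
open Summit.QuantumFields.BalabanUV.T4Continuum.HistoryGen

namespace Summit.QuantumFields.BalabanUV.T4Continuum.HistoryBankingCreditRead

noncomputable section

/-! ## §1 The displayed event-wise factor readings -/

section Read

variable {γ : Type*}

/-- **THE EVENT-WISE FACTOR READING** (HYPOTHESIS SHAPE on the VALUES of M2 brick B's factor data `HistFactors.fB K` ∕
`fR K` at one cutoff; R-class reading, nothing of Bałaban's asserted): a birth factor of a class-`d′` region at step `j`
is a number in `[0, e^{−sB j d′}]` — `sB` the exponent of the «fundamental large field factor» p. 381 ∕ (1.77) BEFORE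
print rounds it in (1.79) p. 383 —, a renewal factor of the level-`h` 𝐑-operation is a number in `[0, e^{−sR h}]` — `sR`
the exponent of the largest preparatory factor of p. 383 BEFORE print rounds it to `p₀(g_h)`.  The letters `sB`, `sR`
are shared with the sibling's `RoundingRoom`. [folklore] -/
structure FactorRead (fB : ℕ → ℕ → γ → ℝ) (fR : ℕ → ℝ) (sB : ℕ → ℕ → ℝ) (sR : ℕ → ℝ) : Prop where
  /-- birth factors are nonnegative -/
  fB_nonneg : ∀ j d n, 0 ≤ fB j d n
  /-- renewal factors are nonnegative -/
  fR_nonneg : ∀ h, 0 ≤ fR h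
  /-- birth factors are below their sharp reading, uniformly in the region -/
  fB_le : ∀ j d n, fB j d n ≤ Real.exp (-sB j d)
  /-- renewal factors are below their sharp reading -/
  fR_le : ∀ h, fR h ≤ Real.exp (-sR h)

variable {fB : ℕ → ℕ → γ → ℝ} {fR : ℕ → ℝ}

/-- event products of nonnegative factors are nonnegative [folklore] -/
theorem evProd_nonneg (hB : ∀ j d n, 0 ≤ fB j d n) (hR : ∀ h, 0 ≤ fR h) : ∀ P : PGen γ, 0 ≤ evProd fB fR P
  | .birth j d n => hB j d n
  | .renew Q h => mul_nonneg (hR h) (evProd_nonneg hB hR Q)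
  | .join X Y _ => mul_nonneg (evProd_nonneg hB hR X) (evProd_nonneg hB hR Y)

end Read

/-! ## §2 The bridge: the event product of `P` against the sharp exponents summed over the tagged genealogy's events -/

section Bridge

variable {γ : Type*} {ε : Type*} [DecidableEq ε] (sh : ε → PEv) {fB : ℕ → ℕ → γ → ℝ} {fR : ℕ → ℝ}
  {sB : ℕ → ℕ → ℝ} {sR : ℕ → ℝ}

/-- **`evProd fB fR P ≤ exp (−Σ_{e ∈ G.events} sharpT sB sR (sh e))`** for a well-formed tagged genealogy `G` whose
shape-relabelling is `P`'s canonical genealogy: births correspond to the kind-`0` events (step `j`, fat `d′`), renewals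
at readiness `h` to the kind-`1` events at step `h + 1`, joins to the kind-`2` events (sharp exponent `0`); the new
label of a renewal ∕ merger is distinct from the old ones (`Gen.WF`). [folklore] -/
theorem evProd_le_exp_neg_sharps (hF : FactorRead fB fR sB sR) {W : ε → ℕ} :
    ∀ (P : PGen γ) (G : Gen ε), relabel sh G = P.toGen → G.WF W →
      evProd fB fR P ≤ Real.exp (-∑ e ∈ G.events, sharpT sB sR (sh e))
  | .birth j cls z, G, hsh, _ => by
      obtain ⟨b, j', rfl⟩ : ∃ b j', G = Gen.born b j' := by
        cases G with
        | born b j' => exact ⟨b, j', rfl⟩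
        | renew _ _ _ => simp [PGen.toGen] at hsh
        | merge _ _ _ => simp [PGen.toGen] at hsh
      simp only [PGen.toGen, relabel_born, Gen.born.injEq] at hsh
      obtain ⟨hb, -⟩ := hsh
      have hk : (sh b).kind = 0 := by rw [hb]; rfl
      rw [Gen.events_born, sum_singleton, sharpT_kind0 hk, hb, PEv.step_mk, PEv.fat_mk, evProd_birth]
      exact hF.fB_le j cls z
  | .renew Q h, G, hsh, hW => by
      obtain ⟨G', e, h', rfl⟩ : ∃ G' e h', G = Gen.renew G' e h' := by
        cases G with
        | born _ _ => simp [PGen.toGen] at hsh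
        | renew G' e h' => exact ⟨G', e, h', rfl⟩
        | merge _ _ _ => simp [PGen.toGen] at hsh
      simp only [PGen.toGen, relabel_renew, Gen.renew.injEq] at hsh
      obtain ⟨hQ, he, -⟩ := hsh
      simp only [Gen.WF] at hW
      have hk : (sh e).kind = 1 := by rw [he]; rfl
      have hs : (sh e).step - 1 = h := by rw [he]; rfl
      have ih := evProd_le_exp_neg_sharps hF Q G' hQ hW.1
      rw [Gen.events_renew, sum_insert hW.2.1, sharpT_kind1 hk, hs, evProd_renew, neg_add, Real.exp_add]
      exact mul_le_mul (hF.fR_le h) ih (evProd_nonneg hF.fB_nonneg hF.fR_nonneg Q) (Real.exp_pos _).le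
  | .join X Y sj, G, hsh, hW => by
      obtain ⟨GX, GY, e, rfl⟩ : ∃ GX GY e, G = Gen.merge GX GY e := by
        cases G with
        | born _ _ => simp [PGen.toGen] at hsh
        | renew _ _ _ => simp [PGen.toGen] at hsh
        | merge GX GY e => exact ⟨GX, GY, e, rfl⟩
      simp only [PGen.toGen, relabel_merge, Gen.merge.injEq] at hsh
      obtain ⟨hX, hY, he⟩ := hsh
      simp only [Gen.WF] at hW
      obtain ⟨hWX, hWY, heX, heY, hXY, -, -⟩ := hW
      have hk : (sh e).kind = 2 := by rw [he]; rfl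
      have hne : e ∉ GX.events ∪ GY.events := by simp [heX, heY]
      have ihX := evProd_le_exp_neg_sharps hF X GX hX hWX
      have ihY := evProd_le_exp_neg_sharps hF Y GY hY hWY
      rw [Gen.events_merge, sum_insert hne, sum_union hXY, sharpT_kind2 hk, zero_add, evProd_join, neg_add,
        Real.exp_add]
      exact mul_le_mul ihX ihY (evProd_nonneg hF.fB_nonneg hF.fR_nonneg Y) (Real.exp_pos _).le

omit [DecidableEq ε] in
/-- the sharp exponent is blind to `shape` (kind, step and — for births — fat are kept) [folklore] -/
theorem sharpT_shape (e : PEv) : sharpT sB sR (shape e) = sharpT sB sR e := by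
  unfold sharpT
  simp only [kind_shape, step_shape]
  by_cases h0 : e.kind = 0
  · rw [if_pos h0, if_pos h0, fat_shape_of_kind0 h0]
  · rw [if_neg h0, if_neg h0]

end Bridge

/-! ## §3 The credit reading: event products against print's booked credits times the count's discount -/

section Credit

variable {γ : Type*} {ε : Type*} [DecidableEq ε] (sh : ε → PEv) {C : T4PrintedShapeBanking.Consts} {O : PrintedO1s}
  {L K : ℕ} {R : ℕ → ℕ} {g : ℕ → ℝ} {β' β₀ : ℝ} {fB : ℕ → ℕ → γ → ℝ} {fR : ℕ → ℝ} {sB : ℕ → ℕ → ℝ} {sR : ℕ → ℝ}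

/-- **THE CREDIT READING (M5-3)**: under the event-wise factor readings `FactorRead`, the rounding-with-room junction
`RoundingRoom`, (2.9) on the run, `L ≥ 1`, `E₂ > 0`, `E₃ ≥ 0`, for a `ConsistentTLE`, well-formed tagged genealogy `G` whose
shape-relabelling is `P`'s canonical genealogy:
`evProd fB fR P ≤ exp (−credits (pcredit O C g ∘ sh) G) · exp (−(8∕E₂·totalCostT sh C K R G + 4·partnerAges (PEv.step ∘ sh) G))`.
[folklore] -/
theorem evProd_le_exp_neg_credits_mul_exp_neg_discount (hF : FactorRead fB fR sB sR)
    (hRR : RoundingRoom C O L K R g sB sR) (h29 : B14FlowStep.FlowIneq29 R g L β' β₀ K) (hL : 1 ≤ L)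
    (hE₂ : 0 < C.E₂) (hE₃ : 0 ≤ C.E₃) {P : PGen γ} {G : Gen ε} (hsh : relabel sh G = P.toGen)
    (hW : G.WF (dictWT sh R C.n₁)) (hc : ConsistentTLE sh C K R G) :
    evProd fB fR P ≤ Real.exp (-credits (pcredit O C g ∘ sh) G) *
      Real.exp (-(8 / C.E₂ * totalCostT sh C K R G + 4 * (partnerAges (PEv.step ∘ sh) G : ℝ))) :=
  (evProd_le_exp_neg_sharps sh hF P G hsh hW).trans (exp_neg_sharps_le h29 hL hE₂ hE₃ hRR hW hc)

variable {α π : Type*} [DecidableEq α] [DecidableEq π] [Inhabited γ]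

/-- **… ON A `Pedigree` (shape `Prod.fst`)**: for a component `c` of a pedigree `Pd` with one-step-older renewed parts
(`hS`, the dictionary's convention), whose tagged genealogy `Pd.genT c` is well formed and `ConsistentTLE` at cutoff `K`:
`evProd fB fR (Pd.toPGen cell c) ≤ exp (−credits (pcredit O C g ∘ Prod.fst) (Pd.genT c)) · exp (−(8∕E₂·totalCostT Prod.fst C
K R (Pd.genT c) + 4·partnerAges (PEv.step ∘ Prod.fst) (Pd.genT c)))` — the per-live-member inequality of `priceM` at
`κ := costT`, credit part (the bridge `shape_genT_eq_toGen` + `sharpT_shape`). [folklore] -/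
theorem evProd_toPGen_le_genT (hF : FactorRead fB fR sB sR) (hRR : RoundingRoom C O L K R g sB sR)
    (h29 : B14FlowStep.FlowIneq29 R g L β' β₀ K) (hL : 1 ≤ L) (hE₂ : 0 < C.E₂) (hE₃ : 0 ≤ C.E₃)
    (Pd : Pedigree α π) (cell : π → γ) (hS : ∀ c c', Part.old c' true ∈ Pd.parts c → Pd.step c' + 1 = Pd.step c) (c : α)
    (hW : (Pd.genT c).WF (dictWT Prod.fst R C.n₁)) (hc : ConsistentTLE Prod.fst C K R (Pd.genT c)) :
    evProd fB fR (Pd.toPGen cell c) ≤ Real.exp (-credits (pcredit O C g ∘ Prod.fst) (Pd.genT c)) *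
      Real.exp (-(8 / C.E₂ * totalCostT Prod.fst C K R (Pd.genT c) +
        4 * (partnerAges (PEv.step ∘ Prod.fst) (Pd.genT c) : ℝ))) := by
  have hb := evProd_le_exp_neg_sharps (shape ∘ Prod.fst) hF (Pd.toPGen cell c) (Pd.genT c)
    (Pd.shape_genT_eq_toGen cell hS c) hW
  have hs : (∑ e ∈ (Pd.genT c).events, sharpT sB sR ((shape ∘ Prod.fst) e)) =
      ∑ e ∈ (Pd.genT c).events, sharpT sB sR (e.1) :=
    sum_congr rfl fun e _ => sharpT_shape e.1
  rw [hs] at hb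
  exact hb.trans (exp_neg_sharps_le h29 hL hE₂ hE₃ hRR hW hc)

end Credit

/-! ## §4 Sanity: the displays are inhabited; the chain on decided toy data (TOY symbols, not print's values) -/

namespace Sanity

/-- the sharp letters exponentiated are a factor reading of themselves [folklore] -/
theorem factorRead_exp {γ : Type*} (sB : ℕ → ℕ → ℝ) (sR : ℕ → ℝ) :
    FactorRead (fun j d (_ : γ) => Real.exp (-sB j d)) (fun h => Real.exp (-sR h)) sB sR where
  fB_nonneg _ _ _ := (Real.exp_pos _).le
  fR_nonneg _ := (Real.exp_pos _).le
  fB_le _ _ _ := le_rfl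
  fR_le _ := le_rfl

/-- toy sharp birth exponents: the booked credit plus the birth's own share plus EVERY merger share of the performed
range (so that any later merger is paid). [folklore] -/
def sB₁ (C : T4PrintedShapeBanking.Consts) (L : ℕ) (R : ℕ → ℕ) (K : ℕ) (O : PrintedO1s) (g : ℕ → ℝ) (j d : ℕ) : ℝ :=
  pcredit O C g ((j, 0, d) : PEv) + dshare C L R ((j, 0, d) : PEv) + ∑ s ∈ Finset.range (K + 1), mshare C L R s

/-- toy sharp renewal exponents: the booked credit plus the renewal's own share. [folklore] -/
def sR₁ (C : T4PrintedShapeBanking.Consts) (L : ℕ) (R : ℕ → ℕ) (O : PrintedO1s) (g : ℕ → ℝ) (h : ℕ) : ℝ :=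
  pcredit O C g ((h + 1, 1, 0) : PEv) + dshare C L R ((h + 1, 1, 0) : PEv)

/-- a kind-`0` event is the triple of its step and class [folklore] -/
theorem eq_mk_of_kind0 {e : PEv} (h : e.kind = 0) : e = ((e.step, 0, e.fat) : PEv) := by
  obtain ⟨s, k, d⟩ := e
  simp only [PEv.kind_mk] at h
  subst h
  rfl

/-- a kind-`1` event's booked credit and share read only its step [folklore] -/
theorem pcredit_add_dshare_kind1 {C : T4PrintedShapeBanking.Consts} {L : ℕ} {R : ℕ → ℕ} {O : PrintedO1s} {g : ℕ → ℝ}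
    {e : PEv} (h : e.kind = 1) (h1 : 1 ≤ e.step) :
    pcredit O C g e + dshare C L R e = sR₁ C L R O g (e.step - 1) := by
  have hk : PEv.kind ((e.step - 1 + 1, 1, 0) : PEv) = 1 := rfl
  have hs : PEv.step ((e.step - 1 + 1, 1, 0) : PEv) = e.step := by
    rw [PEv.step_mk]; omega
  have hw : wt C e = 0 := by simp [wt, h]
  have hw' : wt C ((e.step - 1 + 1, 1, 0) : PEv) = 0 := by simp [wt, hk]
  unfold sR₁ dshare
  rw [pcredit_kind1 h, pcredit_kind1 hk, dictW_kind1 h, dictW_kind1 hk, hw, hw', hs]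

/-- **`RoundingRoom` IS INHABITED** by the toy exponents over ANY constants with `E₂, E₃ ≥ 0`. [folklore] -/
theorem roundingRoom_toy (C : T4PrintedShapeBanking.Consts) (hE₂ : 0 ≤ C.E₂) (hE₃ : 0 ≤ C.E₃) (L K : ℕ) (R : ℕ → ℕ)
    (O : PrintedO1s) (g : ℕ → ℝ) : RoundingRoom C O L K R g (sB₁ C L R K O g) (sR₁ C L R O g) where
  birth e he s _ hsK := by
    rw [eq_mk_of_kind0 he]
    simp only [PEv.step_mk, PEv.fat_mk, sB₁]
    have hmem : s ∈ Finset.range (K + 1) := Finset.mem_range.2 (Nat.lt_succ_of_le hsK)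
    have h := Finset.single_le_sum (f := fun s => mshare C L R s) (fun s _ => mshare_nonneg hE₂ hE₃ s) hmem
    linarith
  renew e he h1 _ := (pcredit_add_dshare_kind1 he h1).le

open T4TaggedShapeBanking.Sanity T4PrintedShapeBanking.XreadC4 HistoryConstants.Sanity

/-- the toy merger's geometric pedigree: two renewed unit regions joined at step `5` [folklore] -/
def P₀ : PGen ℕ := PGen.join (PGen.renew (PGen.birth 0 0 7) 3) (PGen.renew (PGen.birth 0 0 8) 3) 5

/-- its canonical label is the shape-relabelling of the tagged toy `Zt` [folklore] -/
theorem relabel_Zt : relabel Prod.fst Zt = P₀.toGen := rfl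

/-- (2.9) holds trivially on the constant table `R ≡ 2` with `L = 1`, `β₀ = 0` [folklore] -/
theorem flow29_const (g : ℕ → ℝ) (β' : ℝ) : B14FlowStep.FlowIneq29 (fun _ => 2) g 1 β' 0 8 := by
  intro m n _ _
  simp

/-- **THE CHAIN ON THE TOY**: the event product of `P₀` with the exponentiated toy letters is below print's toy credits
times the count's discount of `Zt` (`E₂ = 1 > 0`, `E₃ = 0`). [folklore] -/
example (g : ℕ → ℝ) :
    evProd (fun j d (_ : ℕ) => Real.exp (-sB₁ C₀ 1 (fun _ => 2) 8 O₁ g j d))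
        (fun h => Real.exp (-sR₁ C₀ 1 (fun _ => 2) O₁ g h)) P₀ ≤
      Real.exp (-credits (pcredit O₁ C₀ g ∘ Prod.fst) Zt) *
        Real.exp (-(8 / C₀.E₂ * totalCostT Prod.fst C₀ 8 (fun _ => 2) Zt +
          4 * (partnerAges (PEv.step ∘ Prod.fst) Zt : ℝ))) :=
  evProd_le_exp_neg_credits_mul_exp_neg_discount Prod.fst (factorRead_exp _ _)
    (roundingRoom_toy C₀ (by norm_num [C₀]) (by norm_num [C₀]) 1 8 _ O₁ g) (flow29_const g 0) le_rfl
    (by norm_num [C₀]) (by norm_num [C₀]) relabel_Zt Zt_wf (ConsistentTLE.of_consistentT Zt_consistent.1)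

end Sanity

end

end Summit.QuantumFields.BalabanUV.T4Continuum.HistoryBankingCreditRead
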